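import Summits.AtomisticToContinuum.Crystallization.Theorems.ExcessDecayLiouvilleSiteGeometry
import Summits.AtomisticToContinuum.Crystallization.Theorems.ExcessDecayLiouvilleGrainsGlueField
import Summits.AtomisticToContinuum.Crystallization.Theorems.ExcessDecayLiouvilleHcpLiouvilleDefs

/-!
# `ExcessDecayLiouville.HcpLiouville` (stmt-AtomisticToContinuum-9332), line `Sketch`: one particle per site

Stub `stub_onePerSite` of the line `two-level-caccioppoli` (crux `HcpLiouville`, lead skeleton
`Lines/Sketch.lean`): the common first step ("displacement form").  A `δ`-separated Lennard-Jones
equilibrium `X` (`Sep₀`, `Equil₀`) that is globally two-way `1/40`-matched (`Near₀ X c r t A (1/40)` for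
every centre `c` and radius `r`) with an admissible hcp datum (`Adm₀ A`, `Inner₀ t A`) is
`{s + u s : s ∈ Sites₀ t A}` bijectively with `‖u s‖ ≤ 1/40`, i.e. `IsDisplacement X t A u` for some `u`.

Proof.  Sites are `23/25`-separated (`dist_sites_ge`), so each point is within `1/40` of at most one site
(`site_unique`); matching at radius `0` attaches to every particle a site and to every site a particle.
It remains that the *cluster* `C_s = {p ∈ X | dist p s ≤ 1/40}` of every site `s` has at most one element.
Clusters are finite of uniformly bounded size (packing, `card_le_of_separated_of_dist_le`), so if some
cluster has `≥ 2` elements we may take a site `s₀` whose cluster `C` has maximal size `k ≥ 2`.  Pick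
`p⋆ ∈ C` and `p ∈ C` farthest from `p⋆`; for `q ∈ C ∖ {p}` one has `⟪p − p⋆, p − q⟫ ≥ ‖p − q‖²/2`, and the
force `F_q = (V′(r)/r)(p − q)`, `r = dist p q ≤ 1/20`, satisfies `⟪p − p⋆, F_q⟫ ≤ V′(r)r/2 ≤ −10¹⁵/2`
(`V′(r)r = −r⁻¹² + r⁻⁶`).  Every other particle sits within `1/40` of another site `s′` (at most `k` per
site), at distance `≥ dist s₀ s′ − 1/20 ≥ dist s₀ s′/2` from `p`, so `‖F_q‖ ≤ 8320·dist(s₀,s′)⁻⁶` and the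
lattice sum over the `23/25`-separated sites is `≤ 250·(25/23)⁶` (`sum_inv_pow_six_le_of_forall_le_dist`).
Testing the force balance `HasSum F 0` at `p` against `p − p⋆` (`‖p − p⋆‖ ≤ 1/20`) gives
`0 ≤ −(k−1)·10¹⁵/2 + k·(1/20)·8320·250·(25/23)⁶ < 0`, a contradiction.  All `[folklore]`; a `--supports`
helper for item stmt-AtomisticToContinuum-9332, nothing here closes an item.
-/

noncomputable section

namespace Summit.AtomisticToContinuum.Crystallization.Theorems.ExcessDecayLiouville

open scoped BigOperators Topology Classical InnerProductSpace
open Literature.MathematicalPhysics.StatisticalMechanics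
open Summit.AtomisticToContinuum.Crystallization.Theses.ExcessDecayLiouville
open Summit.AtomisticToContinuum.Crystallization.Theorems.PhononStabilityNegative
open Summit.AtomisticToContinuum.Crystallization.Theorems.ExcessDecayLiouvilleGrainsGlue

local notation "E3" => EuclideanSpace ℝ (Fin 3)

/-! ## Pointwise estimates -/

/-- If `q` is no farther from `r` than `p` is, then `⟪p − r, p − q⟫ ≥ ‖p − q‖²/2`. [folklore] -/
private theorem inner_ge_of_dist_le {p q r : E3} (h : dist q r ≤ dist p r) :
    ‖p - q‖ ^ 2 / 2 ≤ ⟪p - r, p - q⟫_ℝ := by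
  have h1 : ‖q - r‖ ^ 2 ≤ ‖p - r‖ ^ 2 := by
    rw [← dist_eq_norm, ← dist_eq_norm]; exact pow_le_pow_left₀ dist_nonneg h 2
  have h2 : q - r = (p - r) - (p - q) := by abel
  rw [h2, norm_sub_sq_real] at h1
  linarith

/-- `V′(r)·r = −r⁻¹² + r⁻⁶ ≤ −10¹⁵` for `0 < r ≤ 1/20`. [folklore] -/
private theorem deriv_lennardJones_mul_le {r : ℝ} (hr0 : 0 < r) (hr : r ≤ 1 / 20) :
    deriv lennardJones r * r ≤ -(10 : ℝ) ^ 15 := by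
  rw [deriv_lennardJones hr0.ne']
  set x := r⁻¹ with hx
  have hx20 : (20 : ℝ) ≤ x := by
    rw [hx, le_inv_comm₀ (by norm_num) hr0, inv_eq_one_div]; exact hr
  have hxr : x * r = 1 := by rw [hx]; exact inv_mul_cancel₀ hr0.ne'
  have hcalc : (-x ^ 13 + x ^ 7) * r = (-(x ^ 6 * x ^ 6) + x ^ 6) * (x * r) := by ring
  rw [hcalc, hxr, mul_one]
  have h6 : (20 : ℝ) ^ 6 ≤ x ^ 6 := pow_le_pow_left₀ (by norm_num) hx20 6
  have h12 : (20 : ℝ) ^ 6 * x ^ 6 ≤ x ^ 6 * x ^ 6 := mul_le_mul_of_nonneg_right h6 (by positivity)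
  nlinarith

/-- **Inside a cluster.** For `q ≠ p` with `dist p q ≤ 1/20` and `q` no farther from `r` than `p`, the
force `F_q = (V′/·)(p − q)` has component `⟪p − r, F_q⟫ ≤ −10¹⁵/2`. [folklore] -/
private theorem inner_force_le_inside {p q r : E3} (hpq : p ≠ q) (hd : dist p q ≤ 1 / 20)
    (hqr : dist q r ≤ dist p r) :
    ⟪p - r, (deriv lennardJones (dist p q) / dist p q) • (p - q)⟫_ℝ ≤ -(10 : ℝ) ^ 15 / 2 := by
  have hd0 : 0 < dist p q := dist_pos.2 hpq
  have hmul := deriv_lennardJones_mul_le hd0 hd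
  have hV : deriv lennardJones (dist p q) / dist p q ≤ 0 := by
    refine (div_neg_of_neg_of_pos ?_ hd0).le
    by_contra h
    push Not at h
    linarith [mul_nonneg h hd0.le, pow_pos (by norm_num : (0 : ℝ) < 10) 15]
  have hgeom := inner_ge_of_dist_le hqr
  rw [← dist_eq_norm] at hgeom
  rw [real_inner_smul_right]
  calc deriv lennardJones (dist p q) / dist p q * ⟪p - r, p - q⟫_ℝ
      ≤ deriv lennardJones (dist p q) / dist p q * (dist p q ^ 2 / 2) :=
        mul_le_mul_of_nonpos_left hgeom hV
    _ = deriv lennardJones (dist p q) * dist p q / 2 := by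
        field_simp
    _ ≤ -(10 : ℝ) ^ 15 / 2 := by linarith

/-- **Outside the cluster.** If `p` is within `1/40` of `s₀` and `q` within `1/40` of a site `s′` with
`dist s₀ s′ ≥ 23/25`, then `‖F_q‖ ≤ 8320 · dist(s₀, s′)⁻⁶`. [folklore] -/
private theorem norm_force_le_outside {p q s₀ s' : E3} (hss : 23 / 25 ≤ dist s₀ s')
    (hp : dist p s₀ ≤ 1 / 40) (hq : dist q s' ≤ 1 / 40) :
    ‖(deriv lennardJones (dist p q) / dist p q) • (p - q)‖ ≤ 8320 * (dist s₀ s')⁻¹ ^ 6 := by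
  have hD0 : 0 < dist s₀ s' := by linarith
  have htri : dist s₀ s' ≤ dist p s₀ + dist p q + dist q s' := by
    have h1 := dist_triangle4 s₀ p q s'
    rwa [dist_comm s₀ p] at h1
  have hdq : dist s₀ s' / 2 ≤ dist p q := by linarith
  have hd0 : 0 < dist p q := by linarith
  have hhalf : (1 : ℝ) / 2 ≤ dist p q := by linarith
  have h1 : (dist p q)⁻¹ ≤ (dist s₀ s' / 2)⁻¹ := inv_anti₀ (by positivity) hdq
  have h2 : (dist p q)⁻¹ ^ 6 ≤ (dist s₀ s' / 2)⁻¹ ^ 6 :=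
    pow_le_pow_left₀ (inv_nonneg.2 hd0.le) h1 6
  have h3 : ((1 / 2 : ℝ)⁻¹ ^ 7 + (1 / 2 : ℝ)⁻¹) = 130 := by norm_num
  calc ‖(deriv lennardJones (dist p q) / dist p q) • (p - q)‖
      ≤ |deriv lennardJones (dist p q)| := norm_force_le p q
    _ ≤ ((1 / 2 : ℝ)⁻¹ ^ 7 + (1 / 2 : ℝ)⁻¹) * (dist p q)⁻¹ ^ 6 :=
        abs_deriv_lennardJones_le (by norm_num) hhalf
    _ ≤ 130 * (dist s₀ s' / 2)⁻¹ ^ 6 := by rw [h3]; gcongr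
    _ = 8320 * (dist s₀ s')⁻¹ ^ 6 := by
        rw [div_eq_mul_inv, mul_inv, inv_inv]; ring

/-! ## Clusters -/

/-- **Clusters are finite of bounded size**: for a `δ`-separated `X` there is `N` such that every
`{x ∈ X | dist x s ≤ 1/40}` is finite with at most `N` elements (packing). [folklore] -/
private theorem exists_cluster_ncard_le {X : Set E3} {δ : ℝ} (hδ : 0 < δ) (hsep : Sep₀ X δ) :
    ∃ N : ℕ, ∀ s : E3, Set.Finite {x | x ∈ X ∧ dist x s ≤ 1 / 40} ∧
      Set.ncard {x | x ∈ X ∧ dist x s ≤ 1 / 40} ≤ N := by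
  obtain ⟨N, hN⟩ : ∃ N : ℕ, (2 * (1 / 40 : ℝ) / δ + 1) ^ 3 < N := exists_nat_gt _
  refine ⟨N, fun s => ?_⟩
  have key : ∀ T : Finset E3, (↑T ⊆ {x | x ∈ X ∧ dist x s ≤ 1 / 40}) → T.card ≤ N := by
    intro T hT
    have hle := card_le_of_separated_of_dist_le T s hδ (by norm_num : (0 : ℝ) ≤ 1 / 40)
      (fun c hc => (hT hc).2) (fun c hc d hd hcd => hsep c (hT hc).1 d (hT hd).1 hcd)
    rw [finrank_euclideanSpace_fin] at hle
    exact_mod_cast hle.trans hN.le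
  have hfin : Set.Finite {x | x ∈ X ∧ dist x s ≤ 1 / 40} := by
    by_contra hinf
    obtain ⟨T, hTsub, hTcard⟩ := Set.Infinite.exists_subset_card_eq hinf (N + 1)
    have := key T hTsub
    omega
  refine ⟨hfin, ?_⟩
  rw [Set.ncard_eq_toFinset_card _ hfin]
  exact key _ (by rw [Set.Finite.coe_toFinset])

/-- **Forces from outside the cluster of `s₀`** (finite partial sums): if every cluster has at most `k`
points, then over any finite set `W` of particles outside the cluster of `s₀`,
`Σ_{y ∈ W} ‖F_y‖ ≤ k · 8320 · 250 · (25/23)⁶` (group by the attached site, lattice sum over the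
`23/25`-separated sites). [folklore] -/
private theorem sum_norm_force_outside_le {X : Set E3} {t : Fin 2 → E3} {A : E3 →L[ℝ] E3}
    (hA : Adm₀ A) (hI : Inner₀ t A) (hN : ∀ (c : E3) (r : ℝ), Near₀ X c r t A (1 / 40))
    (C : E3 → Set E3) (hC : ∀ s x, x ∈ C s ↔ x ∈ X ∧ dist x s ≤ 1 / 40)
    (hfin : ∀ s, (C s).Finite) {k : ℕ} (hmax : ∀ s ∈ Sites₀ t A, (C s).ncard ≤ k)
    {s₀ p : E3} (hs₀ : s₀ ∈ Sites₀ t A) (hp : dist p s₀ ≤ 1 / 40)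
    (W : Finset E3) (hW : ∀ y ∈ W, y ∈ X ∧ ¬ dist y s₀ ≤ 1 / 40) :
    ∑ y ∈ W, ‖(deriv lennardJones (dist p y) / dist p y) • (p - y)‖ ≤
      k * (8320 * (250 * (23 / 25 : ℝ)⁻¹ ^ 6)) := by
  have hsite : ∀ y ∈ X, ∃ s ∈ Sites₀ t A, dist y s ≤ 1 / 40 := by
    intro y hy
    obtain ⟨m, z, hz, hd⟩ := (hN y 0).1 y hy (by simp)
    exact ⟨t m + A z, ⟨m, z, hz, rfl⟩, hd⟩
  choose! σ hσS hσd using hsite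
  have hne : ∀ y ∈ W, σ y ≠ s₀ := by
    intro y hy h
    have := hσd y (hW y hy).1
    rw [h] at this
    exact (hW y hy).2 this
  have hmaps : ∀ y ∈ W, σ y ∈ W.image σ := fun y hy => Finset.mem_image_of_mem σ hy
  rw [← Finset.sum_fiberwise_of_maps_to hmaps]
  have hfiber : ∀ s' ∈ W.image σ,
      ∑ y ∈ W with σ y = s', ‖(deriv lennardJones (dist p y) / dist p y) • (p - y)‖ ≤
        k * (8320 * (dist s₀ s')⁻¹ ^ 6) := by
    intro s' hs'
    obtain ⟨y₀, hy₀, rfl⟩ := Finset.mem_image.1 hs'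
    have hS' : σ y₀ ∈ Sites₀ t A := hσS y₀ (hW y₀ hy₀).1
    have hss : 23 / 25 ≤ dist s₀ (σ y₀) := dist_sites_ge hA hI hs₀ hS' (hne y₀ hy₀).symm
    have hcard : ((W.filter fun y => σ y = σ y₀).card : ℝ) ≤ k := by
      have h1 : (↑(W.filter fun y => σ y = σ y₀) : Set E3) ⊆ C (σ y₀) := by
        intro y hy
        rw [Finset.coe_filter] at hy
        obtain ⟨hyW, hyσ⟩ := hy
        refine (hC _ _).2 ⟨(hW y hyW).1, ?_⟩
        rw [← hyσ]
        exact hσd y (hW y hyW).1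
      have h2 := Set.ncard_le_ncard h1 (hfin _)
      rw [Set.ncard_coe_finset] at h2
      exact_mod_cast h2.trans (hmax _ hS')
    calc ∑ y ∈ W with σ y = σ y₀, ‖(deriv lennardJones (dist p y) / dist p y) • (p - y)‖
        ≤ ∑ y ∈ W with σ y = σ y₀, 8320 * (dist s₀ (σ y₀))⁻¹ ^ 6 := by
          refine Finset.sum_le_sum fun y hy => ?_
          obtain ⟨hyW, hyσ⟩ := Finset.mem_filter.1 hy
          refine norm_force_le_outside hss hp ?_
          rw [← hyσ]
          exact hσd y (hW y hyW).1
      _ = (W.filter fun y => σ y = σ y₀).card * (8320 * (dist s₀ (σ y₀))⁻¹ ^ 6) := by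
          rw [Finset.sum_const, nsmul_eq_mul]
      _ ≤ k * (8320 * (dist s₀ (σ y₀))⁻¹ ^ 6) := by gcongr
  calc ∑ s' ∈ W.image σ, ∑ y ∈ W with σ y = s', ‖(deriv lennardJones (dist p y) / dist p y) • (p - y)‖
      ≤ ∑ s' ∈ W.image σ, k * (8320 * (dist s₀ s')⁻¹ ^ 6) := Finset.sum_le_sum hfiber
    _ = k * (8320 * ∑ s' ∈ W.image σ, (dist s₀ s')⁻¹ ^ 6) := by
        rw [Finset.mul_sum, Finset.mul_sum]
    _ ≤ k * (8320 * (250 * (23 / 25 : ℝ)⁻¹ ^ 6)) := by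
        gcongr
        refine sum_inv_pow_six_le_of_forall_le_dist _ s₀ (by norm_num) ?_ ?_
        · intro y hy
          obtain ⟨y₀, hy₀, rfl⟩ := Finset.mem_image.1 hy
          exact dist_sites_ge hA hI hs₀ (hσS _ (hW _ hy₀).1) (hne y₀ hy₀).symm
        · intro y hy y' hy' hyy'
          obtain ⟨y₀, hy₀, rfl⟩ := Finset.mem_image.1 hy
          obtain ⟨y₁, hy₁, rfl⟩ := Finset.mem_image.1 hy'
          exact dist_sites_ge hA hI (hσS _ (hW _ hy₀).1) (hσS _ (hW _ hy₁).1) hyy'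

/-- **No cluster of maximal size `k ≥ 2`.** If every cluster has at most `k` points and the cluster of
the site `s₀` has at least `k ≥ 2` points, force balance at the point of the cluster farthest from a
fixed point `p⋆` of it fails (huge outward repulsion inside, bounded forces outside). [folklore] -/
private theorem cluster_not_two_le {X : Set E3} {δ : ℝ} {t : Fin 2 → E3} {A : E3 →L[ℝ] E3}
    (hEq : Equil₀ X) (hA : Adm₀ A) (hI : Inner₀ t A)
    (hN : ∀ (c : E3) (r : ℝ), Near₀ X c r t A (1 / 40))
    (C : E3 → Set E3) (hC : ∀ s x, x ∈ C s ↔ x ∈ X ∧ dist x s ≤ 1 / 40)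
    (hfin : ∀ s, (C s).Finite) {k : ℕ} (hmax : ∀ s ∈ Sites₀ t A, (C s).ncard ≤ k)
    {s₀ : E3} (hs₀ : s₀ ∈ Sites₀ t A) (hk : 2 ≤ k) (hks₀ : k ≤ (C s₀).ncard) (_hδ : 0 < δ)
    (_hsep : Sep₀ X δ) : False := by
  -- the cluster of `s₀` as a finset
  set Cf := (hfin s₀).toFinset with hCf
  have hmemCf : ∀ x, x ∈ Cf ↔ x ∈ X ∧ dist x s₀ ≤ 1 / 40 := fun x => by
    rw [hCf, Set.Finite.mem_toFinset, hC]
  have hcardk : k ≤ Cf.card := by rwa [Set.ncard_eq_toFinset_card _ (hfin s₀)] at hks₀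
  have hcard2 : 1 < Cf.card := by omega
  -- a fixed point `r` of the cluster and the point `p` of the cluster farthest from it
  obtain ⟨r, hr, p', hp', hrp'⟩ := Finset.one_lt_card.1 hcard2
  obtain ⟨p, hp, hpmax⟩ := Finset.exists_max_image Cf (fun x => dist x r) ⟨r, hr⟩
  have hpr : p ≠ r := by
    intro h
    have h1 := hpmax p' hp'
    rw [h, dist_self] at h1
    exact hrp' (dist_le_zero.1 h1).symm
  obtain ⟨hpX, hps₀⟩ := (hmemCf p).1 hp
  obtain ⟨-, hrs₀⟩ := (hmemCf r).1 hr
  have hv : ‖p - r‖ ≤ 1 / 20 := by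
    rw [← dist_eq_norm]; linarith [dist_triangle p s₀ r, dist_comm s₀ r]
  -- force balance at `p`, tested against `p - r`
  have hφ : HasSum (fun q : {q : E3 // q ∈ X ∧ q ≠ p} =>
      ⟪p - r, (deriv lennardJones (dist p q.1) / dist p q.1) • (p - q.1)⟫_ℝ) 0 := by
    simpa only [innerSL_apply_apply, inner_zero_right] using (hEq p hpX).mapL (innerSL ℝ (p - r))
  -- the inside indices
  set T : Finset {q : E3 // q ∈ X ∧ q ≠ p} := Cf.subtype (fun q => q ∈ X ∧ q ≠ p) with hT
  have hmemT : ∀ q : {q : E3 // q ∈ X ∧ q ≠ p}, q ∈ T ↔ dist q.1 s₀ ≤ 1 / 40 := by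
    intro q
    rw [hT, Finset.mem_subtype, hmemCf]
    exact ⟨fun h => h.2, fun h => ⟨q.2.1, h⟩⟩
  have hcardT : T.card + 1 = Cf.card := by
    rw [hT, Finset.card_subtype]
    have : Cf.filter (fun q => q ∈ X ∧ q ≠ p) = Cf.erase p := by
      ext x
      simp only [Finset.mem_filter, Finset.mem_erase, hmemCf]
      tauto
    rw [this, Finset.card_erase_of_mem hp]
    omega
  have hsum := hφ.summable
  have hsplit := hsum.sum_add_tsum_subtype_compl T
  rw [hφ.tsum_eq] at hsplit
  -- inside: every term is `≤ -10¹⁵/2`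
  have hin : ∑ q ∈ T, ⟪p - r, (deriv lennardJones (dist p q.1) / dist p q.1) • (p - q.1)⟫_ℝ ≤
      T.card • (-(10 : ℝ) ^ 15 / 2) := by
    refine Finset.sum_le_card_nsmul T _ _ fun q hq => ?_
    have hq' := (hmemT q).1 hq
    refine inner_force_le_inside (Ne.symm q.2.2) ?_ (hpmax q.1 ((hmemCf q.1).2 ⟨q.2.1, hq'⟩))
    linarith [dist_triangle p s₀ q.1, dist_comm s₀ q.1]
  rw [nsmul_eq_mul] at hin
  -- outside: bounded by `(1/20) · k · 8320 · 250 · (25/23)⁶`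
  have hout : ∑' q : {q : {q : E3 // q ∈ X ∧ q ≠ p} // q ∉ T},
      ⟪p - r, (deriv lennardJones (dist p q.1.1) / dist p q.1.1) • (p - q.1.1)⟫_ℝ ≤
        1 / 20 * (k * (8320 * (250 * (23 / 25 : ℝ)⁻¹ ^ 6))) := by
    refine (hsum.subtype _).tsum_le_of_sum_le fun u => ?_
    have hinj : Set.InjOn (fun q : {q : {q : E3 // q ∈ X ∧ q ≠ p} // q ∉ T} => q.1.1) u :=
      fun a _ b _ h => Subtype.ext (Subtype.ext h)
    have hWsum : ∑ q ∈ u, ‖(deriv lennardJones (dist p q.1.1) / dist p q.1.1) • (p - q.1.1)‖ ≤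
        k * (8320 * (250 * (23 / 25 : ℝ)⁻¹ ^ 6)) := by
      rw [← Finset.sum_image
        (f := fun y : E3 => ‖(deriv lennardJones (dist p y) / dist p y) • (p - y)‖) hinj]
      refine sum_norm_force_outside_le hA hI hN C hC hfin hmax hs₀ hps₀ _ fun y hy => ?_
      obtain ⟨q, -, rfl⟩ := Finset.mem_image.1 hy
      exact ⟨q.1.2.1, fun h => q.2 ((hmemT q.1).2 h)⟩
    calc ∑ q ∈ u, ⟪p - r, (deriv lennardJones (dist p q.1.1) / dist p q.1.1) • (p - q.1.1)⟫_ℝ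
        ≤ ∑ q ∈ u, ‖p - r‖ * ‖(deriv lennardJones (dist p q.1.1) / dist p q.1.1) • (p - q.1.1)‖ :=
          Finset.sum_le_sum fun q _ => real_inner_le_norm _ _
      _ = ‖p - r‖ * ∑ q ∈ u, ‖(deriv lennardJones (dist p q.1.1) / dist p q.1.1) • (p - q.1.1)‖ := by
          rw [Finset.mul_sum]
      _ ≤ 1 / 20 * (k * (8320 * (250 * (23 / 25 : ℝ)⁻¹ ^ 6))) :=
          mul_le_mul hv hWsum (Finset.sum_nonneg fun _ _ => norm_nonneg _) (by norm_num)
  -- bookkeeping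
  have hK : (k : ℝ) * (8320 * (250 * (23 / 25 : ℝ)⁻¹ ^ 6)) ≤ k * (4 * 10 ^ 6) := by
    have : (8320 * (250 * (23 / 25 : ℝ)⁻¹ ^ 6)) ≤ 4 * 10 ^ 6 := by norm_num
    exact mul_le_mul_of_nonneg_left this (Nat.cast_nonneg k)
  have hk2 : (2 : ℝ) ≤ k := by exact_mod_cast hk
  have hTk : (k : ℝ) ≤ T.card + 1 := by exact_mod_cast hcardT.symm ▸ hcardk
  linarith

/-- **At most one particle per site.** Under the hypotheses of the stub (`δ`-separation, force
balance, global two-way `1/40`-matching with an admissible hcp datum), two particles within `1/40` of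
the same site coincide. [folklore] -/
theorem onePerSite_atMostOne : ∀ δ : ℝ, 0 < δ → ∀ X : Set E3, Sep₀ X δ → Equil₀ X → ∀ (t : Fin 2 → E3) (A : E3 →L[ℝ] E3), Adm₀ A → Inner₀ t A → (∀ (c : E3) (r : ℝ), Near₀ X c r t A (1 / 40)) → ∀ s ∈ Sites₀ t A, ∀ p ∈ X, ∀ q ∈ X, dist p s ≤ 1 / 40 → dist q s ≤ 1 / 40 → p = q := by
  intro δ hδ X hsep hEq t A hA hI hN
  obtain ⟨N, hN'⟩ := exists_cluster_ncard_le hδ hsep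
  have hex : ∃ k : ℕ, ∀ s ∈ Sites₀ t A, Set.ncard {x | x ∈ X ∧ dist x s ≤ 1 / 40} ≤ k :=
    ⟨N, fun s _ => (hN' s).2⟩
  have hkspec := Nat.find_spec hex
  by_cases hk1 : Nat.find hex ≤ 1
  · intro s hs p hp q hq hps hqs
    exact (Set.ncard_le_one (hN' s).1).1 ((hkspec s hs).trans hk1) p ⟨hp, hps⟩ q ⟨hq, hqs⟩
  · exfalso
    push Not at hk1
    have hmin := Nat.find_min hex (show Nat.find hex - 1 < Nat.find hex by omega)
    push Not at hmin
    obtain ⟨s₀, hs₀, hlt⟩ := hmin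
    exact cluster_not_two_le hEq hA hI hN (fun s => {x | x ∈ X ∧ dist x s ≤ 1 / 40})
      (fun s x => Iff.rfl) (fun s => (hN' s).1) hkspec hs₀ (by omega) (by omega) hδ hsep

/-! ## The stub -/

/-- **Stub `stub_onePerSite` (line `Sketch`, crux `HcpLiouville`)**: displacement form — a separated
Lennard-Jones equilibrium globally two-way `1/40`-matched with an admissible hcp datum is a bounded
(`≤ 1/40`) displacement of the reference two-lattice, bijectively. [folklore] -/
theorem stub_onePerSite : ∀ δ : ℝ, 0 < δ → ∀ X : Set E3, Sep₀ X δ → Equil₀ X → ∀ (t : Fin 2 → E3) (A : E3 →L[ℝ] E3), Adm₀ A → Inner₀ t A → (∀ (c : E3) (r : ℝ), Near₀ X c r t A (1 / 40)) → ∃ u : E3 → E3, IsDisplacement X t A u := by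
  intro δ hδ X hsep hEq t A hA hI hN
  have h1 := onePerSite_atMostOne δ hδ X hsep hEq t A hA hI hN
  have hsurj : ∀ s ∈ Sites₀ t A, ∃ p ∈ X, dist p s ≤ 1 / 40 := by
    rintro s ⟨m, z, hz, rfl⟩
    exact (hN (t m + A z) 0).2 m z hz (by simp)
  choose! π hπX hπd using hsurj
  refine ⟨fun s => π s - s, fun s hs => ?_, fun s hs => ?_, fun s hs s' hs' h => ?_, fun p hp => ?_⟩
  · rw [← dist_eq_norm]; exact hπd s hs
  · simpa using hπX s hs
  · simp only [add_sub_cancel] at h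
    refine site_unique hA hI (by norm_num : (1 / 40 : ℝ) < 23 / 50) hs hs' (hπd s hs) ?_
    rw [h]; exact hπd s' hs'
  · obtain ⟨m, z, hz, hd⟩ := (hN p 0).1 p hp (by simp)
    refine ⟨t m + A z, ⟨m, z, hz, rfl⟩, ?_⟩
    simp only [add_sub_cancel]
    exact h1 _ ⟨m, z, hz, rfl⟩ _ (hπX _ ⟨m, z, hz, rfl⟩) p hp (hπd _ ⟨m, z, hz, rfl⟩) hd

end Summit.AtomisticToContinuum.Crystallization.Theorems.ExcessDecayLiouville

end
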